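import Mathlib
import Summits.NavierStokesRegularity.FluidComputer.BorderedEigenpairMaster
import Summits.NavierStokesRegularity.FluidComputer.BorderedResolventIsolationNested
import Summits.NavierStokesRegularity.FluidComputer.BorderedHeadTailBoundNested

/-!
# THEOREM 3-B-NESTED assembled in resolvent coordinates — the form the certificate rows of record use: column `ṽ` (float vector at `K_V > K₀`), row `ṽ_h`, head `Â₀` bordered by `ṽ_h`, tail with the rank-one `ṽ_t` terms (profile-cert-3 g4, cell `ns-blowup`, 2026-08-26)

HONEST FRAMING (human rulings D-0035/D-0074): nothing here is a claim about Navier–Stokes blow-up.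
WHAT THIS IS NOT: not NS evidence. Abstract Hilbert-space theorems whose hypotheses have the SHAPE of
a 3-B-NESTED row (cap `SKEWCUT-PAIR.md` §9 (N1)–(N7); `CertificateAbcSpectrum*`, F5, three
implementations) and whose conclusions are the printed words («EXACTLY ONE eigenpair within ρ of
(ṽ, λ̃), normalised ⟨v⋆, ṽ_h⟩ = ⟨ṽ, ṽ_h⟩; ALGEBRAICALLY SIMPLE; σ ∩ {|z − λ⋆| < r_iso} = {λ⋆}»). This is
`BorderedEigenpairMaster` with the column vector `S₀ w̃ = ṽ` and the row vector `vr = ṽ_h` decoupled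
(there both were `ṽ`), composed with `BorderedHeadTailBoundNested` (the nested a-priori bound with
the `ṽ_t` rank-one terms, (N4)/(N5)) and `BorderedResolventIsolationNested`.

* `existsUnique_eigenpair_of_apriori_nested` — 3-B (b): a-priori bound
  `‖(S₀ y, μ)‖ ≤ M‖(R_λ̃ y + μ ṽ, ⟪vr, S₀ y⟫)‖`, `‖r‖ ≤ r₀`, `κ = 2√2M²r₀ < 1` ⇒ EXACTLY ONE `(v, λ)` in the
  ball `ρ = 2Mr₀` with `v = S₀ w`, `R_λ w = 0`, `⟪vr, v⟫ = ⟪vr, ṽ⟫`.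
* `certified_eigenpair_nested` — (b) ∧ (c) ∧ (d).
* `certified_eigenpair_of_row_nested` — hypotheses in NESTED ROW form: head left inverse of
  `(u, m) ↦ (P R u + m P ṽ, ⟪vr, S₀ u⟫)` with `α, β_B`, nested `β_C′` and nested tail coercivity `μ_eff`,
  residual `r₀`, `κ` with the printed `M₀`; `vr ∈ U` (no hypothesis `ṽ ∈ U`).

Mathlib + the three files named; no new definitions. bears_on LADDER-NS N5 / Z4-a(1)(2); evidence-only
for `EpisodeBase` (stmt-NavierStokesRegularity-19179).
-/

open scoped InnerProductSpace

namespace Summit.NavierStokesRegularity.FluidComputer.BorderedEigenpairMasterNested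

variable {𝕜 H : Type*} [RCLike 𝕜] [NormedAddCommGroup H] [InnerProductSpace 𝕜 H] [CompleteSpace H]

/-- **THEOREM 3-B-NESTED (b) in resolvent coordinates** (row vector `vr = ṽ_h` decoupled from the
column `ṽ = S₀ w̃`). `S₀` compact and injective, `1 − T` invertible
(`H` complete); float datum `(λ̃, w̃)`, `ṽ = S₀ w̃`, residual `r = R_λ̃ w̃` with `‖r‖ ≤ r₀`; the
A-PRIORI BOUND `‖(S₀ y, μ)‖ ≤ M‖(R_λ̃ y + μṽ, ⟪ṽ, S₀ y⟫)‖` (3-B (a)); `κ := 2√2·M²·r₀ < 1` (H3). Then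
there is EXACTLY ONE `p = (v, λ) ∈ H ⊕₂ 𝕜` with `‖p − (ṽ, λ̃)‖ ≤ ρ := 2Mr₀` which is a NORMALISED
EIGENPAIR: `v = S₀ w` for some `w` with `R_λ w = 0` (i.e. `v ∈ D(L)`, `(λ − L)v = 0`) and
`⟪vr, v⟫ = ⟪vr, ṽ⟫` (`⟨v, ṽ_h⟩ = ⟨ṽ, ṽ_h⟩`). [folklore] -/
theorem existsUnique_eigenpair_of_apriori_nested (S₀ T : H →L[𝕜] H) (hS₀c : IsCompactOperator S₀)
    (hS₀ : Function.Injective S₀) (hT : IsUnit ((1 : H →L[𝕜] H) - T)) (x₀ lt : 𝕜) (wt vr : H)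
    {M r₀ : ℝ} (hM : 0 ≤ M) (hr₀ : 0 ≤ r₀)
    (hapr : ∀ (y : H) (μ : 𝕜), ‖WithLp.toLp 2 (S₀ y, μ)‖ ≤ M *
      ‖WithLp.toLp 2 (((1 : H →L[𝕜] H) - T - (x₀ - lt) • S₀) y + μ • S₀ wt, ⟪vr, S₀ y⟫_𝕜)‖)
    (hres : ‖((1 : H →L[𝕜] H) - T - (x₀ - lt) • S₀) wt‖ ≤ r₀)
    (hκ : 2 * Real.sqrt 2 * M ^ 2 * r₀ < 1) :
    ∃! p : WithLp 2 (H × 𝕜), ‖p - WithLp.toLp 2 (S₀ wt, lt)‖ ≤ 2 * M * r₀ ∧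
      (∃ w : H, S₀ w = p.fst ∧ ((1 : H →L[𝕜] H) - T - (x₀ - p.snd) • S₀) w = 0) ∧
      ⟪vr, p.fst⟫_𝕜 = ⟪vr, S₀ wt⟫_𝕜 := by
  set Rt : H →L[𝕜] H := (1 : H →L[𝕜] H) - T - (x₀ - lt) • S₀ with hRt
  set vt : H := S₀ wt with hvt
  -- the bordered operator and its inverse (3-B (a), existence half by Fredholm)
  obtain ⟨B, hB⟩ := BorderedResolventFredholm.exists_borderedCLM Rt vt ((innerSL 𝕜 vr) ∘L S₀)
  have hB' : ∀ w μ, B (WithLp.toLp 2 (w, μ)) = WithLp.toLp 2 (Rt w + μ • vt, ⟪vr, S₀ w⟫_𝕜) :=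
    fun w μ => by rw [hB]; rfl
  have hapr' : ∀ (y : H) (μ : 𝕜), ‖WithLp.toLp 2 (S₀ y, μ)‖ ≤ M * ‖B (WithLp.toLp 2 (y, μ))‖ :=
    fun y μ => by rw [hB']; exact hapr y μ
  have hK : IsCompactOperator ((-(x₀ - lt)) • S₀ : H →L[𝕜] H) := hS₀c.smul (-(x₀ - lt))
  have hB'' : ∀ w μ, B (WithLp.toLp 2 (w, μ)) =
      WithLp.toLp 2 ((((1 : H →L[𝕜] H) - T) + (-(x₀ - lt)) • S₀) w + μ • vt,
        ((innerSL 𝕜 vr) ∘L S₀) w) := fun w μ => by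
    rw [hB', hRt, neg_smul, ← sub_eq_add_neg]; rfl
  obtain ⟨Binv, hBBinv, hBinvB, S, hSM, hS⟩ :=
    BorderedResolventFredholm.bordered_inverse_of_apriori ((1 : H →L[𝕜] H) - T) ((-(x₀ - lt)) • S₀) S₀
      hT hK hS₀ vt ((innerSL 𝕜 vr) ∘L S₀) B hB'' hM hapr'
  -- Newton map data on `X = H ⊕₂ 𝕜`
  set X₀ : WithLp 2 (H × 𝕜) := WithLp.toLp 2 (vt, lt) with hX₀
  set Rh : WithLp 2 (H × 𝕜) := WithLp.toLp 2 (Rt wt, (0 : 𝕜)) with hRh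
  set Q : WithLp 2 (H × 𝕜) → WithLp 2 (H × 𝕜) :=
    fun x => WithLp.toLp 2 ((x.snd - lt) • (x.fst - vt), (0 : 𝕜)) with hQ
  have hRh_norm : ‖Rh‖ ≤ r₀ := by rw [hRh, WithLp.norm_toLp_fst]; exact hres
  have hball : ∀ x ∈ Metric.closedBall X₀ (2 * M * r₀),
      ‖x.fst - vt‖ ^ 2 + ‖x.snd - lt‖ ^ 2 ≤ (2 * M * r₀) ^ 2 := by
    intro x hx
    rw [Metric.mem_closedBall, dist_eq_norm] at hx
    rw [← BorderedEigenpairMaster.norm_sub_toLp_sq]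
    exact pow_le_pow_left₀ (norm_nonneg _) hx 2
  have hQ0 : ∀ x ∈ Metric.closedBall X₀ (2 * M * r₀), ‖Q x‖ ≤ (2 * M * r₀) ^ 2 / 2 := by
    intro x hx
    rw [hQ, WithLp.norm_toLp_fst]
    exact BorderedEigenpairFixedPoint.norm_quad_le vt x.fst lt x.snd (hball x hx)
  have hQ1 : ∀ x ∈ Metric.closedBall X₀ (2 * M * r₀), ∀ x' ∈ Metric.closedBall X₀ (2 * M * r₀),
      ‖Q x - Q x'‖ ≤ Real.sqrt 2 * (2 * M * r₀) * ‖x - x'‖ := by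
    intro x hx x' hx'
    have h := BorderedEigenpairFixedPoint.norm_quad_sub_quad_le vt x.fst x'.fst lt x.snd x'.snd
      (by positivity) (hball x hx) (hball x' hx')
    have hn : Real.sqrt (‖x.fst - x'.fst‖ ^ 2 + ‖x.snd - x'.snd‖ ^ 2) = ‖x - x'‖ := by
      rw [← BorderedHeadTailBound.norm_toLp_sq, Real.sqrt_sq (norm_nonneg _), ← Prod.mk_sub_mk,
        WithLp.toLp_sub]
      rfl
    rw [hQ, ← WithLp.toLp_sub, Prod.mk_sub_mk, sub_zero, WithLp.norm_toLp_fst, ← hn]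
    exact h
  obtain ⟨p, ⟨hp, hpfix⟩, huniq⟩ :=
    BorderedEigenpairFixedPoint.existsUnique_fixedPoint_of_kappa_lt_one S X₀ Rh Q hM hr₀ hSM
      hRh_norm hκ hQ0 hQ1
  -- fixed points of the Newton map ↔ normalised eigenpairs (K-B5′ + the inverse)
  have key : ∀ q : WithLp 2 (H × 𝕜), q = X₀ - S (Rh + Q q) ↔
      ((∃ w : H, S₀ w = q.fst ∧ ((1 : H →L[𝕜] H) - T - (x₀ - q.snd) • S₀) w = 0) ∧
        ⟪vr, q.fst⟫_𝕜 = ⟪vr, vt⟫_𝕜) := by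
    intro q
    have hRQ : Rh + Q q = WithLp.toLp 2 (Rt wt + (q.snd - lt) • (q.fst - vt), (0 : 𝕜)) := by
      rw [hRh, hQ, ← WithLp.toLp_add, Prod.mk_add_mk, add_zero]
    constructor
    · intro hq
      set y : H := (Binv (Rh + Q q)).fst with hy
      set μ : 𝕜 := (Binv (Rh + Q q)).snd with hμ
      have hSq : S (Rh + Q q) = WithLp.toLp 2 (S₀ y, μ) := hS _
      have hq1 : q.fst = vt - S₀ y := by
        have := congrArg WithLp.fst hq
        rw [hSq] at this; simpa [hX₀] using this
      have hq2 : q.snd = lt - μ := by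
        have := congrArg WithLp.snd hq
        rw [hSq] at this; simpa [hX₀] using this
      have hByμ : B (WithLp.toLp 2 (y, μ)) = Rh + Q q := by
        have : WithLp.toLp 2 (y, μ) = Binv (Rh + Q q) := rfl
        rw [this, hBBinv]
      rw [hB', hRQ] at hByμ
      have hc1 : Rt y + μ • vt = Rt wt + (q.snd - lt) • (q.fst - vt) := by
        have := congrArg WithLp.fst hByμ; simpa using this
      have hc2 : ⟪vr, S₀ y⟫_𝕜 = 0 := by
        have := congrArg WithLp.snd hByμ; simpa using this
      refine ⟨⟨wt - y, by rw [map_sub, hq1], ?_⟩, ?_⟩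
      · -- K-B5′ with `w = wt - y`, `l = q.snd`
        have hiff := BorderedResolventIsolation.pencil_bordered_iff_eigen
          (((1 : H →L[𝕜] H) - T - x₀ • S₀ : H →L[𝕜] H) : H →ₗ[𝕜] H) (S₀ : H →ₗ[𝕜] H) wt (wt - y)
          lt q.snd
        rw [BorderedResolventIsolation.resolventCoord_apply]
        refine hiff.mp ?_
        simp only [ContinuousLinearMap.coe_coe, sub_sub_cancel, map_sub]
        rw [← BorderedResolventIsolation.resolventCoord_apply S₀ T x₀ lt y, ← BorderedResolventIsolation.resolventCoord_apply S₀ T x₀ lt wt,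
          show lt - q.snd = μ by rw [hq2]; ring, hc1, hq1, hvt]
      · rw [hq1, inner_sub_right, hc2, sub_zero]
    · rintro ⟨⟨w, hw, hRw⟩, hnorm⟩
      set y : H := wt - w with hy
      set μ : 𝕜 := lt - q.snd with hμ
      -- by K-B5′ the pair `(y, μ)` solves the bordered equation with datum `Rh + Q q`
      have hc1 : Rt y + μ • vt = Rt wt + (q.snd - lt) • (q.fst - vt) := by
        have hiff := BorderedResolventIsolation.pencil_bordered_iff_eigen
          (((1 : H →L[𝕜] H) - T - x₀ • S₀ : H →L[𝕜] H) : H →ₗ[𝕜] H) (S₀ : H →ₗ[𝕜] H) wt w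
          lt q.snd
        rw [BorderedResolventIsolation.resolventCoord_apply] at hRw
        have h := hiff.mpr hRw
        simp only [ContinuousLinearMap.coe_coe] at h
        rw [← BorderedResolventIsolation.resolventCoord_apply S₀ T x₀ lt (wt - w), ← BorderedResolventIsolation.resolventCoord_apply S₀ T x₀ lt wt,
          hw] at h
        rw [hy, hμ, hvt]
        exact h
      have hc2 : ⟪vr, S₀ y⟫_𝕜 = 0 := by
        rw [hy, map_sub, hw, inner_sub_right, ← hvt, hnorm, sub_self]
      have hByμ : B (WithLp.toLp 2 (y, μ)) = Rh + Q q := by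
        rw [hB', hRQ, hc1, hc2]
      have hBinv : Binv (Rh + Q q) = WithLp.toLp 2 (y, μ) := by rw [← hByμ, hBinvB]
      have hSq : S (Rh + Q q) = WithLp.toLp 2 (S₀ y, μ) := by rw [hS, hBinv]; rfl
      rw [hSq, hX₀, ← WithLp.toLp_sub, Prod.mk_sub_mk, hy, hμ, map_sub, hw, ← hvt, sub_sub_cancel,
        sub_sub_cancel]
      rfl
  refine ⟨p, ⟨?_, (key p).mp hpfix⟩, fun q hq => huniq q ⟨?_, (key q).mpr hq.2⟩⟩
  · rwa [Metric.mem_closedBall, dist_eq_norm] at hp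
  · rw [Metric.mem_closedBall, dist_eq_norm]; exact hq.1

/-! ## §2 THEOREM 3-B (b) ∧ (c) ∧ (d) from the a-priori bound -/

/-- **THEOREM 3-B-NESTED (b)(c)(d) in resolvent coordinates, from the a-priori bound** (row `vr`).
Under the hypotheses
of `existsUnique_eigenpair_of_apriori_nested` with `M > 0`: there are `λ⋆` and `w⋆` (`v⋆ = S₀ w⋆`) with
(b) `R_λ⋆ w⋆ = 0`, `‖v⋆ − ṽ‖² + |λ⋆ − λ̃|² ≤ ρ²` (`ρ = 2Mr₀`), `⟪vr, v⋆⟫ = ⟪vr, ṽ⟫`, and `(λ⋆, w⋆)` is the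
ONLY normalised eigenpair in that ball; (c) `ker R_λ⋆ = span{w⋆}` and no chain `R_λ⋆ y₁ = S₀ y₂`,
`R_λ⋆ y₂ = 0`, `y₂ ≠ 0` (geometric AND algebraic simplicity of `λ⋆` for `L`, `D(L) = range S₀`);
(d) for `0 < |z − λ⋆| < r_iso := (1 − κ)/M`, `κ = 2√2M²r₀`, the operator `R_z` is INVERTIBLE
(`z − L : D(L) → H` bijective: `σ(L) ∩ {|z − λ⋆| < r_iso} = {λ⋆}`). [folklore] -/
theorem certified_eigenpair_nested (S₀ T : H →L[𝕜] H) (hS₀c : IsCompactOperator S₀)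
    (hS₀ : Function.Injective S₀) (hT : IsUnit ((1 : H →L[𝕜] H) - T)) (x₀ lt : 𝕜) (wt vr : H)
    {M r₀ : ℝ} (hM : 0 < M) (hr₀ : 0 ≤ r₀)
    (hapr : ∀ (y : H) (μ : 𝕜), ‖WithLp.toLp 2 (S₀ y, μ)‖ ≤ M *
      ‖WithLp.toLp 2 (((1 : H →L[𝕜] H) - T - (x₀ - lt) • S₀) y + μ • S₀ wt, ⟪vr, S₀ y⟫_𝕜)‖)
    (hres : ‖((1 : H →L[𝕜] H) - T - (x₀ - lt) • S₀) wt‖ ≤ r₀)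
    (hκ : 2 * Real.sqrt 2 * M ^ 2 * r₀ < 1) :
    ∃ lam : 𝕜, ∃ ws : H,
      (((1 : H →L[𝕜] H) - T - (x₀ - lam) • S₀) ws = 0 ∧
        ‖S₀ ws - S₀ wt‖ ^ 2 + ‖lam - lt‖ ^ 2 ≤ (2 * M * r₀) ^ 2 ∧
        ⟪vr, S₀ ws⟫_𝕜 = ⟪vr, S₀ wt⟫_𝕜) ∧
      (∀ (lam' : 𝕜) (w' : H), ((1 : H →L[𝕜] H) - T - (x₀ - lam') • S₀) w' = 0 →
        ‖S₀ w' - S₀ wt‖ ^ 2 + ‖lam' - lt‖ ^ 2 ≤ (2 * M * r₀) ^ 2 →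
        ⟪vr, S₀ w'⟫_𝕜 = ⟪vr, S₀ wt⟫_𝕜 → lam' = lam ∧ w' = ws) ∧
      (∀ y : H, ((1 : H →L[𝕜] H) - T - (x₀ - lam) • S₀) y = 0 →
        y = (⟪vr, S₀ y⟫_𝕜 / ⟪vr, S₀ ws⟫_𝕜) • ws) ∧
      (∀ y₁ y₂ : H, ((1 : H →L[𝕜] H) - T - (x₀ - lam) • S₀) y₁ = S₀ y₂ →
        ((1 : H →L[𝕜] H) - T - (x₀ - lam) • S₀) y₂ = 0 → y₂ = 0) ∧
      (∀ z : 𝕜, z ≠ lam → ‖z - lam‖ < (1 - 2 * Real.sqrt 2 * M ^ 2 * r₀) / M →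
        IsUnit ((1 : H →L[𝕜] H) - T - (x₀ - z) • S₀)) := by
  obtain ⟨p, ⟨hp, ⟨ws, hws, hR⟩, hnorm⟩, huniq⟩ :=
    existsUnique_eigenpair_of_apriori_nested S₀ T hS₀c hS₀ hT x₀ lt wt vr hM.le hr₀ hapr hres hκ
  have hball : ‖S₀ ws - S₀ wt‖ ^ 2 + ‖p.snd - lt‖ ^ 2 ≤ (2 * M * r₀) ^ 2 := by
    rw [hws, ← BorderedEigenpairMaster.norm_sub_toLp_sq]
    exact pow_le_pow_left₀ (norm_nonneg _) hp 2
  have hρ : 0 ≤ 2 * M * r₀ := by positivity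
  have hκ' : Real.sqrt 2 * M * (2 * M * r₀) < 1 := by
    calc Real.sqrt 2 * M * (2 * M * r₀) = 2 * Real.sqrt 2 * M ^ 2 * r₀ := by ring
      _ < 1 := hκ
  have hMρ : M * (2 * M * r₀) < 1 := by
    have h2 : (1 : ℝ) ≤ Real.sqrt 2 := Real.one_le_sqrt.mpr (by norm_num)
    have : M * (2 * M * r₀) ≤ Real.sqrt 2 * M * (2 * M * r₀) := by
      nlinarith [mul_nonneg hM.le hρ]
    exact lt_of_le_of_lt this hκ'
  obtain ⟨hker, hchain⟩ := BorderedResolventIsolationNested.simple_of_apriori_nested S₀ T hS₀ x₀ lt p.snd (S₀ wt) vr ws hM.le hρ hMρ hapr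
    hball hR
  refine ⟨p.snd, ws, ⟨hR, hball, by rw [hws]; exact hnorm⟩, ?_, hker, hchain, ?_⟩
  · intro lam' w' hR' hball' hnorm'
    have hq := huniq (WithLp.toLp 2 (S₀ w', lam')) ⟨?_, ⟨w', rfl, hR'⟩, hnorm'⟩
    · refine ⟨by rw [← hq]; rfl, hS₀ ?_⟩
      rw [hws, ← hq]; rfl
    · have h1 : ‖WithLp.toLp 2 (S₀ w', lam') - WithLp.toLp 2 (S₀ wt, lt)‖ ^ 2 ≤ (2 * M * r₀) ^ 2 := by
        rw [BorderedEigenpairMaster.norm_sub_toLp_sq]; exact hball'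
      exact (pow_le_pow_iff_left₀ (norm_nonneg _) hρ two_ne_zero).mp h1
  · intro z hz hnear
    refine BorderedResolventIsolationNested.isUnit_resolventCoord_of_lt_rIso_nested S₀ T hS₀c hS₀ hT x₀ lt p.snd (S₀ wt) vr ws hM hρ hκ' hapr
      hball hR hz ?_
    calc ‖z - p.snd‖ < (1 - 2 * Real.sqrt 2 * M ^ 2 * r₀) / M := hnear
      _ = (1 - Real.sqrt 2 * M * (2 * M * r₀)) / M := by ring

/-! ## §3 THEOREM 3-B from the row data (head / tail / residual / κ) -/

/-- **THEOREM 3-B-NESTED, hypotheses in row form (SKEWCUT-PAIR §9 (N2)/(N4)/(N5)).** `H` complete;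
RESOLVENT COORDINATES: `S₀` compact,
injective, preserving the head `U` (a complete subspace: the cube truncation) and `Uᗮ`; `1 − T`
invertible; float datum `(λ̃, w̃)`, `ṽ = S₀ w̃` (NOT assumed in `U`); `R := 1 − T − (x₀ − λ̃)S₀`.
(H1) HEAD: a linear left inverse `Ainv` of the NESTED head `(u, μ) ↦ (P R u + μ P ṽ, ⟪vr, S₀ u⟫)`
(`vr ∈ U` the row `ṽ_h`; `ṽ = S₀ w̃` arbitrary; nested `β_C′`, `μ_eff` with the `ṽ − P ṽ` rank-one terms) on
`U × 𝕜` with the printed `α, β_B, β_C′` (in the `v = S₀ w` measure; `BorderedHeadTailBoundNested`);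
(H2) TAIL: `μ‖S₀ w‖² ≤ Re⟪R w − R a.1 − a.2 • (ṽ − P ṽ), S₀ w⟫`, `a = Ainv (P R w, 0)`, on `Uᗮ`, `μ > 0`
(the certified `μ_eff` of (N4));
(H0) residual `‖R w̃‖ ≤ r₀`; (H3) `κ := 2√2·M₀²·r₀ < 1` with the printed
`M₀ = √((1 + β_C²)/μ² + (α + β_B√(1 + β_C²)/μ)²)`.
CONCLUSIONS = those of `certified_eigenpair_nested` with `M = M₀`: the unique normalised eigenpair in the ball
of radius `ρ = 2M₀r₀`, algebraically simple, and `R_z` invertible on `0 < |z − λ⋆| < (1 − κ)/M₀` —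
the printed «3-B CERTIFIED» sentence, kernel-checked modulo model ASSEMBLY and outward rounding.
[folklore] -/
theorem certified_eigenpair_of_row_nested (S₀ T : H →L[𝕜] H) (hS₀c : IsCompactOperator S₀)
    (hS₀ : Function.Injective S₀) (hT : IsUnit ((1 : H →L[𝕜] H) - T)) (x₀ lt : 𝕜)
    (U : Submodule 𝕜 H) [U.HasOrthogonalProjection]
    (hS₀U : ∀ u ∈ U, S₀ u ∈ U) (hS₀U' : ∀ w ∈ Uᗮ, S₀ w ∈ Uᗮ) (wt vr : H) (hvr : vr ∈ U)
    (Ainv : (H × 𝕜) →ₗ[𝕜] (H × 𝕜))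
    (hAleft : ∀ u ∈ U, ∀ m : 𝕜,
      Ainv (U.starProjection (((1 : H →L[𝕜] H) - T - (x₀ - lt) • S₀) u) +
        m • U.starProjection (S₀ wt), ⟪vr, S₀ u⟫_𝕜) = (u, m))
    {α βB βC μ r₀ : ℝ} (hμ : 0 < μ) (hα : 0 ≤ α) (hβB : 0 ≤ βB) (hβC : 0 ≤ βC) (hr₀ : 0 ≤ r₀)
    (hαb : ∀ y ∈ U, ∀ g : 𝕜,
      ‖WithLp.toLp 2 (S₀ (Ainv (y, g)).1, (Ainv (y, g)).2)‖ ≤ α * ‖WithLp.toLp 2 (y, g)‖)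
    (hβBb : ∀ w ∈ Uᗮ,
      ‖WithLp.toLp 2 (S₀ (Ainv (U.starProjection (((1 : H →L[𝕜] H) - T - (x₀ - lt) • S₀) w), 0)).1,
          (Ainv (U.starProjection (((1 : H →L[𝕜] H) - T - (x₀ - lt) • S₀) w), 0)).2)‖ ≤
        βB * ‖S₀ w‖)
    (hβCb : ∀ y ∈ U, ∀ g : 𝕜,
      ‖((1 : H →L[𝕜] H) - T - (x₀ - lt) • S₀) (Ainv (y, g)).1 -
          U.starProjection (((1 : H →L[𝕜] H) - T - (x₀ - lt) • S₀) (Ainv (y, g)).1) +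
          (Ainv (y, g)).2 • (S₀ wt - U.starProjection (S₀ wt))‖ ≤ βC * ‖WithLp.toLp 2 (y, g)‖)
    (hcoer : ∀ w ∈ Uᗮ, μ * ‖S₀ w‖ ^ 2 ≤
      RCLike.re ⟪((1 : H →L[𝕜] H) - T - (x₀ - lt) • S₀) w -
        ((1 : H →L[𝕜] H) - T - (x₀ - lt) • S₀)
          (Ainv (U.starProjection (((1 : H →L[𝕜] H) - T - (x₀ - lt) • S₀) w), 0)).1 -
        (Ainv (U.starProjection (((1 : H →L[𝕜] H) - T - (x₀ - lt) • S₀) w), 0)).2 •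
          (S₀ wt - U.starProjection (S₀ wt)), S₀ w⟫_𝕜)
    (hres : ‖((1 : H →L[𝕜] H) - T - (x₀ - lt) • S₀) wt‖ ≤ r₀)
    (hκ : 2 * Real.sqrt 2 *
      (√((1 + βC ^ 2) / μ ^ 2 + (α + βB * √(1 + βC ^ 2) / μ) ^ 2)) ^ 2 * r₀ < 1) :
    ∃ lam : 𝕜, ∃ ws : H,
      (((1 : H →L[𝕜] H) - T - (x₀ - lam) • S₀) ws = 0 ∧
        ‖S₀ ws - S₀ wt‖ ^ 2 + ‖lam - lt‖ ^ 2 ≤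
          (2 * √((1 + βC ^ 2) / μ ^ 2 + (α + βB * √(1 + βC ^ 2) / μ) ^ 2) * r₀) ^ 2 ∧
        ⟪vr, S₀ ws⟫_𝕜 = ⟪vr, S₀ wt⟫_𝕜) ∧
      (∀ (lam' : 𝕜) (w' : H), ((1 : H →L[𝕜] H) - T - (x₀ - lam') • S₀) w' = 0 →
        ‖S₀ w' - S₀ wt‖ ^ 2 + ‖lam' - lt‖ ^ 2 ≤
          (2 * √((1 + βC ^ 2) / μ ^ 2 + (α + βB * √(1 + βC ^ 2) / μ) ^ 2) * r₀) ^ 2 →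
        ⟪vr, S₀ w'⟫_𝕜 = ⟪vr, S₀ wt⟫_𝕜 → lam' = lam ∧ w' = ws) ∧
      (∀ y : H, ((1 : H →L[𝕜] H) - T - (x₀ - lam) • S₀) y = 0 →
        y = (⟪vr, S₀ y⟫_𝕜 / ⟪vr, S₀ ws⟫_𝕜) • ws) ∧
      (∀ y₁ y₂ : H, ((1 : H →L[𝕜] H) - T - (x₀ - lam) • S₀) y₁ = S₀ y₂ →
        ((1 : H →L[𝕜] H) - T - (x₀ - lam) • S₀) y₂ = 0 → y₂ = 0) ∧
      (∀ z : 𝕜, z ≠ lam → ‖z - lam‖ <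
          (1 - 2 * Real.sqrt 2 *
            (√((1 + βC ^ 2) / μ ^ 2 + (α + βB * √(1 + βC ^ 2) / μ) ^ 2)) ^ 2 * r₀) /
            √((1 + βC ^ 2) / μ ^ 2 + (α + βB * √(1 + βC ^ 2) / μ) ^ 2) →
        IsUnit ((1 : H →L[𝕜] H) - T - (x₀ - z) • S₀)) := by
  have hM : 0 < √((1 + βC ^ 2) / μ ^ 2 + (α + βB * √(1 + βC ^ 2) / μ) ^ 2) := by
    apply Real.sqrt_pos.mpr
    have h1 : 0 < (1 + βC ^ 2) / μ ^ 2 := by positivity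
    positivity
  have hapr := BorderedHeadTailBoundNested.apriori_bound_of_nested_head_tail_inner
    ((1 : H →L[𝕜] H) - T - (x₀ - lt) • S₀) S₀ U hS₀U hS₀U' (S₀ wt) vr hvr Ainv hAleft hμ hα hβB
    hβC hαb hβBb hβCb hcoer
  exact certified_eigenpair_nested S₀ T hS₀c hS₀ hT x₀ lt wt vr hM hr₀ hapr hres hκ

/-! ## §4 Reality of the certified eigenvalue by isolation ((N7), remark r6) -/

/-- **(N7) REALITY in resolvent coordinates (over `ℂ`).** Post-composes with the conclusions of
`certified_eigenpair_nested` / `certified_eigenpair_of_row_nested`: a certified pair `(λ⋆, w⋆)` with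
`R_λ⋆ w⋆ = 0`, `S₀ w⋆ ≠ 0` (e.g. from the normalisation `⟪vr, S₀ w⋆⟫ = ⟪vr, ṽ⟫ ≠ 0`), `|λ⋆ − λ̃| ≤ ρ`
with `λ̃` REAL, the isolation clause «`R_z` invertible for `0 < |z − λ⋆| < r_iso`», `2ρ < r_iso`, and the
MODEL symmetry «`R_z` not invertible ⇒ `R_{conj z}` not invertible» (L real, the class `J`-invariant —
assembly item (A5)) give `λ⋆ ∈ ℝ`, by `BorderedEigenpairFixedPoint.im_eq_zero_of_isolated` applied to
`σ := {z | ¬ IsUnit R_z}`. [folklore] -/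
theorem im_eq_zero_of_certified {H : Type*} [NormedAddCommGroup H] [InnerProductSpace ℂ H]
    [CompleteSpace H] (S₀ T : H →L[ℂ] H) (x₀ : ℂ) (lt : ℝ) (lam : ℂ) (ws : H)
    (hws : ((1 : H →L[ℂ] H) - T - (x₀ - lam) • S₀) ws = 0) (hws0 : S₀ ws ≠ 0)
    {ρ riso : ℝ} (hclose : ‖lam - (lt : ℂ)‖ ≤ ρ) (h2ρ : 2 * ρ < riso)
    (hiso : ∀ z : ℂ, z ≠ lam → ‖z - lam‖ < riso → IsUnit ((1 : H →L[ℂ] H) - T - (x₀ - z) • S₀))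
    (hconj : ∀ z : ℂ, ¬ IsUnit ((1 : H →L[ℂ] H) - T - (x₀ - z) • S₀) →
      ¬ IsUnit ((1 : H →L[ℂ] H) - T - (x₀ - (starRingEnd ℂ) z) • S₀)) :
    lam.im = 0 := by
  set σ : Set ℂ := {z | ¬ IsUnit ((1 : H →L[ℂ] H) - T - (x₀ - z) • S₀)} with hσ
  have hlam : lam ∈ σ := by
    intro hu
    have hinj := (ContinuousLinearMap.isUnit_iff_bijective.mp hu).1
    have h0 : ws = 0 := hinj (by rw [hws, map_zero])
    exact hws0 (by rw [h0, map_zero])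
  refine BorderedEigenpairFixedPoint.im_eq_zero_of_isolated σ (fun z hz => hconj z hz) lt lam hlam hclose
    (fun z hz hdist => ?_) h2ρ
  by_contra hne
  exact hz (hiso z hne hdist)

end Summit.NavierStokesRegularity.FluidComputer.BorderedEigenpairMasterNested
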